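import Summits.Schanuel.Schanuel.Theorems.RootDecomp1HCyclesCell

/-!
# RootDecomp1H — ROUND 10 «CYCLIC CELLS», part 4 of 5 (§5 the instrument at a cycle: cyclic substitution, tangent 3-plane, SrcExcl / ImgExcl)

All parts (`RootDecomp1HCyclesCore` §1+§2a, `RootDecomp1HCyclesRigid` §2b, `RootDecomp1HCyclesCell` §3–§4, `RootDecomp1HCyclesInstrument` §5,
`RootDecomp1HCycles` §6–§8) share the namespace `Summit.Schanuel.Schanuel.Theorems.RootDecomp1HCycles`; importers use `RootDecomp1HCycles`. lens-5 g10 (port rev d ac33957a); `--supports stmt-Schanuel-30564`.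
See part 1 (`RootDecomp1HCyclesCore`) for the account of the round.
-/

set_option linter.dupNamespace false

noncomputable section

namespace Summit.Schanuel.Schanuel.Theorems.RootDecomp1HCycles

open Complex Set
open Literature.NumberTheory.Transcendental (exists_nsmul_mem_span_int mem_adjoin_of_mem_span_int SchanuelRank Khovanskii.ePD)
open Summit.Schanuel.Schanuel.Theses.RootDecomp1H (ProductSchanuel RelTowerSchanuel BridgeTransverse FinCS)
open Summit.Schanuel.Schanuel.Theorems.RootDecomp1HTowerCells (trdeg_adjoin_adjoin_eq trdeg_adjoin_union_le
  trdeg_adjoin_range_le)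
open Summit.Schanuel.Schanuel.Theorems.RootDecomp1HCurveHull
open Summit.Schanuel.Schanuel.Theorems.RootDecomp1HClearance (LowerRanks CounterEx InTowerHull)
open Summit.Schanuel.Schanuel.Theorems.RootDecomp1HWitness
open Summit.Schanuel.Schanuel.Theorems.RootDecomp1HGauge

/-! ## 5. The instrument at a cycle: the cyclic substitution and the tangent 3-plane -/

section instrument

variable (ε c : Fin 3 → ℤ)

/-- Images of the six variables under the CYCLIC SUBSTITUTION `X_j ↦ ε_{j−1} U_{j−1} + c_{j−1}`, `Y_j ↦ U_j`. -/
def substFun : Fin 3 ⊕ Fin 3 → MvPolynomial (Fin 3) ℤ :=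
  Sum.elim (fun j => MvPolynomial.C (ε (j - 1)) * MvPolynomial.X (j - 1) + MvPolynomial.C (c (j - 1)))
    (fun j => MvPolynomial.X j)

/-- The cyclic substitution `ℤ[X, Y] → ℤ[U]`. -/
def cycSubst : MvPolynomial (Fin 3 ⊕ Fin 3) ℤ →ₐ[ℤ] MvPolynomial (Fin 3) ℤ := MvPolynomial.aeval (substFun ε c)

/-- Re-embedding `ℤ[U] → ℤ[X, Y]`, `U_j ↦ Y_j`. -/
def reembed : MvPolynomial (Fin 3) ℤ →ₐ[ℤ] MvPolynomial (Fin 3 ⊕ Fin 3) ℤ := MvPolynomial.rename Sum.inr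

/-- The cycle equations as integer polynomials: `ℓ_j = X_{j+1} − ε_j Y_j − c_j`. -/
def ell (j : Fin 3) : MvPolynomial (Fin 3 ⊕ Fin 3) ℤ :=
  MvPolynomial.X (Sum.inl (j + 1)) - MvPolynomial.C (ε j) * MvPolynomial.X (Sum.inr j) - MvPolynomial.C (c j)

/-- The GRADIENT of an integer polynomial at the point `(y, e^y)` (as in `IsCertificate`). -/
def grad (P : MvPolynomial (Fin 3 ⊕ Fin 3) ℤ) (y : Fin 3 → ℂ) : Fin 3 ⊕ Fin 3 → ℂ :=
  fun s => MvPolynomial.aeval (Sum.elim y (cexp ∘ y)) (MvPolynomial.pderiv s P)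

/-- The TANGENT 3-PLANE: the `ℂ`-span of the gradients of the three cycle equations. -/
def tangentPlane (y : Fin 3 → ℂ) : Submodule ℂ (Fin 3 ⊕ Fin 3 → ℂ) :=
  Submodule.span ℂ (Set.range fun j => grad (ell ε c j) y)

/-- EXCLUSION AT SIZE `N` (the census predicate): every integer polynomial of size `≤ N` whose cyclic image vanishes at `u`
has ZERO cyclic image.  (Images have total degree `≤ N` by `totalDegree_cycSubst_le` and, for unit parameters and `N = 4`,
height `≤ 4·C(10,4)·2⁴ = 13 440`; so a certified absence of integer relations of degree `≤ 4` and height `≤ 13 440` among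
`u₀, u₁, u₂` implies `SrcExcl ε c u 4`.) -/
def SrcExcl (u : Fin 3 → ℂ) (N : ℕ) : Prop :=
  ∀ P : MvPolynomial (Fin 3 ⊕ Fin 3) ℤ, psize P ≤ N → MvPolynomial.aeval u (cycSubst ε c P) = 0 → cycSubst ε c P = 0

variable {ε c} {y : Fin 3 → ℂ}

/-- the cyclic substitution on an `X`-variable. -/
theorem substFun_inl (j : Fin 3) :
    substFun ε c (Sum.inl j) = MvPolynomial.C (ε (j - 1)) * MvPolynomial.X (j - 1) + MvPolynomial.C (c (j - 1)) := rfl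

/-- `substFun ε c (Sum.inr j) = MvPolynomial.X j`. -/
theorem substFun_inr (j : Fin 3) : substFun ε c (Sum.inr j) = MvPolynomial.X j := rfl

/-- The substitution evaluates correctly at a cycle: `(substFun s)(u) = (y, e^y)_s`. -/
theorem aeval_substFun (h : IsIntCycle ε c y) (s : Fin 3 ⊕ Fin 3) :
    MvPolynomial.aeval (cexp ∘ y) (substFun ε c s) = Sum.elim y (cexp ∘ y) s := by
  rcases s with j | j
  · rw [substFun_inl, Sum.elim_inl, map_add, map_mul, MvPolynomial.aeval_C, MvPolynomial.aeval_C, MvPolynomial.aeval_X]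
    have := h (j - 1)
    rw [sub_add_cancel] at this
    rw [this]; simp
  · rw [substFun_inr]; simp

/-- `(cycSubst P)(u) = P(y, e^y)`. -/
theorem aeval_cycSubst (h : IsIntCycle ε c y) (P : MvPolynomial (Fin 3 ⊕ Fin 3) ℤ) :
    MvPolynomial.aeval (cexp ∘ y) (cycSubst ε c P) = MvPolynomial.aeval (Sum.elim y (cexp ∘ y)) P := by
  have hcomp := MvPolynomial.comp_aeval (R := ℤ) (f := substFun ε c)
    (MvPolynomial.aeval (cexp ∘ y) : MvPolynomial (Fin 3) ℤ →ₐ[ℤ] ℂ)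
  have h2 : (fun i => MvPolynomial.aeval (cexp ∘ y) (substFun ε c i)) = Sum.elim y (cexp ∘ y) :=
    funext (aeval_substFun h)
  rw [h2] at hcomp
  exact AlgHom.congr_fun hcomp P

/-- `(reembed G)(y, e^y) = G(u)`. -/
theorem aeval_reembed (G : MvPolynomial (Fin 3) ℤ) :
    MvPolynomial.aeval (Sum.elim y (cexp ∘ y)) (reembed G) = MvPolynomial.aeval (cexp ∘ y) G := by
  rw [reembed, MvPolynomial.aeval_rename, Sum.elim_comp_inr]

/-- `grad (P + Q) y = grad P y + grad Q y`. -/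
theorem grad_add (P Q : MvPolynomial (Fin 3 ⊕ Fin 3) ℤ) : grad (P + Q) y = grad P y + grad Q y := by
  funext s; simp [grad]

/-- `grad (P - Q) y = grad P y - grad Q y`. -/
theorem grad_sub (P Q : MvPolynomial (Fin 3 ⊕ Fin 3) ℤ) : grad (P - Q) y = grad P y - grad Q y := by
  funext s; simp [grad]

/-- `grad (0 : MvPolynomial (Fin 3 ⊕ Fin 3) ℤ) y = 0`. -/
theorem grad_zero : grad (0 : MvPolynomial (Fin 3 ⊕ Fin 3) ℤ) y = 0 := by
  funext s; simp [grad]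

/-- `grad (MvPolynomial.C a : MvPolynomial (Fin 3 ⊕ Fin 3) ℤ) y = 0`. -/
theorem grad_C (a : ℤ) : grad (MvPolynomial.C a : MvPolynomial (Fin 3 ⊕ Fin 3) ℤ) y = 0 := by
  funext s; simp [grad]

/-- Leibniz. -/
theorem grad_mul (P Q : MvPolynomial (Fin 3 ⊕ Fin 3) ℤ) :
    grad (P * Q) y = MvPolynomial.aeval (Sum.elim y (cexp ∘ y)) P • grad Q y +
      MvPolynomial.aeval (Sum.elim y (cexp ∘ y)) Q • grad P y := by
  funext s
  simp only [grad, MvPolynomial.pderiv_mul, map_add, map_mul, Pi.add_apply, Pi.smul_apply, smul_eq_mul]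
  ring

/-- The re-embedded image of `X_{j}` differs from `X_j` by the cycle equation `ℓ_{j−1}`. -/
theorem X_inl_sub_reembed (j : Fin 3) :
    MvPolynomial.X (Sum.inl j) - reembed (cycSubst ε c (MvPolynomial.X (Sum.inl j))) = ell ε c (j - 1) := by
  rw [cycSubst, MvPolynomial.aeval_X, substFun_inl, reembed, map_add, map_mul, MvPolynomial.rename_C,
    MvPolynomial.rename_C, MvPolynomial.rename_X, ell, sub_add_cancel]
  ring

/-- `X_{inr j}` minus its re-embedding under the cyclic substitution. -/
theorem X_inr_sub_reembed (j : Fin 3) :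
    MvPolynomial.X (Sum.inr j) - reembed (cycSubst ε c (MvPolynomial.X (Sum.inr j))) = 0 := by
  rw [cycSubst, MvPolynomial.aeval_X, substFun_inr, reembed, MvPolynomial.rename_X, sub_self]

/-- **THE TANGENT LEMMA** (Leibniz induction): for every integer polynomial `P`, the gradient of `P` at `(y, e^y)` differs
from the gradient of the re-embedded cyclic image by a vector of the tangent 3-plane. -/
theorem grad_sub_grad_reembed_mem (h : IsIntCycle ε c y) (P : MvPolynomial (Fin 3 ⊕ Fin 3) ℤ) :
    grad P y - grad (reembed (cycSubst ε c P)) y ∈ tangentPlane ε c y := by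
  induction P using MvPolynomial.induction_on with
  | C a =>
    rw [cycSubst, MvPolynomial.aeval_C, reembed, MvPolynomial.algebraMap_eq, MvPolynomial.rename_C, grad_C, sub_zero]
    exact zero_mem _
  | add p q hp hq =>
    rw [map_add, map_add, grad_add, grad_add, add_sub_add_comm]
    exact add_mem hp hq
  | mul_X p s hp =>
    have hval : ∀ Q : MvPolynomial (Fin 3 ⊕ Fin 3) ℤ,
        MvPolynomial.aeval (Sum.elim y (cexp ∘ y)) (reembed (cycSubst ε c Q)) =
          MvPolynomial.aeval (Sum.elim y (cexp ∘ y)) Q := fun Q => by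
      rw [aeval_reembed, aeval_cycSubst h]
    have hX : grad (MvPolynomial.X s : MvPolynomial (Fin 3 ⊕ Fin 3) ℤ) y -
        grad (reembed (cycSubst ε c (MvPolynomial.X s))) y ∈ tangentPlane ε c y := by
      rw [← grad_sub]
      rcases s with j | j
      · rw [X_inl_sub_reembed]; exact Submodule.subset_span ⟨j - 1, rfl⟩
      · rw [X_inr_sub_reembed, grad_zero]; exact zero_mem _
    rw [map_mul, map_mul, grad_mul, grad_mul, hval, hval]
    convert add_mem (Submodule.smul_mem _ (MvPolynomial.aeval (Sum.elim y (cexp ∘ y)) p) hX)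
      (Submodule.smul_mem _ (MvPolynomial.aeval (Sum.elim y (cexp ∘ y)) (MvPolynomial.X s : MvPolynomial _ ℤ)) hp)
      using 1
    rw [smul_sub, smul_sub]; abel

/-- **IN THE KERNEL ⟹ TANGENT**: an integer polynomial with ZERO cyclic image has its gradient at `(y, e^y)` in the tangent
3-plane. -/
theorem grad_mem_of_cycSubst_eq_zero (h : IsIntCycle ε c y) {P : MvPolynomial (Fin 3 ⊕ Fin 3) ℤ}
    (hP : cycSubst ε c P = 0) : grad P y ∈ tangentPlane ε c y := by
  have := grad_sub_grad_reembed_mem h P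
  rwa [hP, map_zero, grad_zero, sub_zero] at this

/-- **NO SMALL CERTIFICATE AT AN EXCLUDED CYCLE**: if every size-`≤ N` integer polynomial with cyclic image vanishing at
`u = e^y` has zero image, then no transverse integer certificate of size `≤ N` exists at `y` (four gradients in a 3-plane). -/
theorem no_certificate_of_srcExcl (h : IsIntCycle ε c y) {N : ℕ} (hex : SrcExcl ε c (cexp ∘ y) N) :
    ¬ ∃ P : Fin (3 + 1) → MvPolynomial (Fin 3 ⊕ Fin 3) ℤ, (∀ i, psize (P i) ≤ N) ∧ IsCertificate 3 y P := by
  rintro ⟨P, hsize, hzero, hli⟩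
  have hmem : ∀ i, grad (P i) y ∈ tangentPlane ε c y := fun i =>
    grad_mem_of_cycSubst_eq_zero h (hex (P i) (hsize i) (by rw [aeval_cycSubst h]; exact hzero i))
  haveI : FiniteDimensional ℂ (tangentPlane ε c y) := FiniteDimensional.span_of_finite ℂ (Set.finite_range _)
  have hV : Module.finrank ℂ (tangentPlane ε c y) ≤ 3 :=
    (finrank_range_le_card (R := ℂ) (fun j : Fin 3 => grad (ell ε c j) y)).trans (by simp)
  let b : Fin (3 + 1) → tangentPlane ε c y := fun i => ⟨grad (P i) y, hmem i⟩
  have hb : LinearIndependent ℂ b := LinearIndependent.of_comp (tangentPlane ε c y).subtype hli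
  have h4 := hb.fintype_card_le_finrank
  rw [Fintype.card_fin] at h4
  omega

/-- **THE INSTRUMENT INSTANCE AT AN EXCLUDED CYCLE**: the `(3, 1, y)`-instance of `FinCSAt g` holds (second disjunct) as soon as
`SrcExcl ε c (e^y) (g 3 1)` is certified — whatever the status of `LowerRanks 3`, near-optimality or conjugation-stability. -/
theorem finCS_cell_of_srcExcl (h : IsIntCycle ε c y) {g : ℕ → ℕ → ℕ} (hex : SrcExcl ε c (cexp ∘ y) (g 3 1)) :
    LowerRanks 3 → NearOpt 3 1 y → ConjStable y →
      (¬ LinearIndependent ℚ y ∨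
        ¬ ∃ P : Fin (3 + 1) → MvPolynomial (Fin 3 ⊕ Fin 3) ℤ, (∀ i, psize (P i) ≤ g 3 1) ∧ IsCertificate 3 y P) :=
  fun _ _ _ => Or.inr (no_certificate_of_srcExcl h hex)

/-- **THE RESIDUAL AT AN EXCLUDED CYCLE, READ EXACTLY.**  At a near-optimal conjugation-stable cycle off the hull with
`SrcExcl` certified, the `(3, 1, y)`-instance of `BridgeAt g` (for `g = stdGauge`: of `BridgeTransverse`) is equivalent to
«`LowerRanks 3 →` `y` is not a counterexample», i.e. to Schanuel's inequality at `y` given Schanuel in ranks `< 3`. -/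
theorem bridge_cell_iff (h : IsIntCycle ε c y) {g : ℕ → ℕ → ℕ} (hex : SrcExcl ε c (cexp ∘ y) (g 3 1))
    (hopt : NearOpt 3 1 y) (hcs : ConjStable y) (hnh : ¬ InTowerHull y) :
    (LowerRanks 3 → NearOpt 3 1 y → ConjStable y → CounterEx y → ¬ InTowerHull y →
        ∃ P : Fin (3 + 1) → MvPolynomial (Fin 3 ⊕ Fin 3) ℤ, (∀ i, psize (P i) ≤ g 3 1) ∧ IsCertificate 3 y P) ↔
      (LowerRanks 3 → ¬ CounterEx y) := by
  constructor
  · exact fun hB hlow hce => no_certificate_of_srcExcl h hex (hB hlow hopt hcs hce hnh)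
  · exact fun hN hlow _ _ hce _ => absurd hce (hN hlow)

/-- `y` is a counterexample iff it is `ℚ`-free with `trdeg ℚ(e^{y₀}, e^{y₁}, e^{y₂}) < 3`. -/
theorem counterEx_cycle_iff {r c' : Fin 3 → ℚ} (h : IsCycle r c' y) :
    CounterEx y ↔ LinearIndependent ℚ y ∧
      Algebra.trdeg ℚ ↥(IntermediateField.adjoin ℚ (range (cexp ∘ y))) < (3 : Cardinal) := by
  have key : Algebra.trdeg ℚ ↥(IntermediateField.adjoin ℚ (range y ∪ range (cexp ∘ y))) =
      Algebra.trdeg ℚ ↥(IntermediateField.adjoin ℚ (range (cexp ∘ y))) :=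
    congrArg (fun F : IntermediateField ℚ ℂ => Algebra.trdeg ℚ ↥F) h.adjoin_cycle_eq
  constructor
  · rintro ⟨h1, h2⟩
    exact ⟨h1, lt_of_eq_of_lt key.symm (by exact_mod_cast h2)⟩
  · rintro ⟨h1, h2⟩
    exact ⟨h1, by exact_mod_cast lt_of_eq_of_lt key h2⟩

/-- Images under the cyclic substitution do not increase the total degree. -/
theorem totalDegree_substFun_le (s : Fin 3 ⊕ Fin 3) : (substFun ε c s).totalDegree ≤ 1 := by
  rcases s with j | j
  · rw [substFun_inl]
    refine (MvPolynomial.totalDegree_add _ _).trans (max_le ?_ ?_)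
    · exact (MvPolynomial.totalDegree_mul _ _).trans
        (by rw [MvPolynomial.totalDegree_C, MvPolynomial.totalDegree_X, zero_add])
    · rw [MvPolynomial.totalDegree_C]; exact zero_le_one
  · rw [substFun_inr, MvPolynomial.totalDegree_X]

/-- `(cycSubst ε c P).totalDegree ≤ P.totalDegree`. -/
theorem totalDegree_cycSubst_le (P : MvPolynomial (Fin 3 ⊕ Fin 3) ℤ) : (cycSubst ε c P).totalDegree ≤ P.totalDegree := by
  classical
  rw [cycSubst, MvPolynomial.aeval_eq_eval₂Hom, MvPolynomial.coe_eval₂Hom, MvPolynomial.eval₂_eq']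
  refine MvPolynomial.totalDegree_finsetSum_le fun d hd => (MvPolynomial.totalDegree_mul _ _).trans ?_
  rw [MvPolynomial.algebraMap_eq, MvPolynomial.totalDegree_C, zero_add]
  refine (MvPolynomial.totalDegree_finsetProd _ _).trans ?_
  calc ∑ i, (substFun ε c i ^ d i).totalDegree ≤ ∑ i, d i := Finset.sum_le_sum fun i _ =>
          (MvPolynomial.totalDegree_pow _ _).trans (by simpa using Nat.mul_le_mul_left (d i) (totalDegree_substFun_le i))
    _ = d.sum fun _ e => e := by rw [Finsupp.sum_fintype _ _ (fun _ => rfl)]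
    _ ≤ P.totalDegree := MvPolynomial.le_totalDegree hd

end instrument

end Summit.Schanuel.Schanuel.Theorems.RootDecomp1HCycles
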